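import Mathlib

/-!
# Sketch (strategist s1, crux NestingRigidity stmt-CriticalPhenomena-4835): first lemmas of the line `fair-coin-routing`

(1) ROUTING-KERNEL LEMMA — the finitary heart of `RoutingTransfer`: if on two probability spaces the routing word `b`
is UNIFORM given the coarse arc system `t`, the loops are `F t b`, the blind data are `G t b` and `t` is recoverable
from the blind data, then equal BLIND laws force equal LOOP laws (the conditional law of the loops given the blind
data is one kernel).  Stated over finite types; the line needs its approximate (total-variation) version.
(2) `LoopLimitZ2EqT → LoopLimitZ2Blind` is PROVED in `StrategistSplit.lean` (`loopLimitZ2Blind_of_loopLimitZ2EqT`).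
-/

open Finset

/-- **Routing-kernel lemma** (exact, finitary). -/
theorem routingKernel {Θ Β Λ Ξ : Type*} [Fintype Θ] [Fintype Β] [DecidableEq Ξ] [DecidableEq Λ]
    (F : Θ → Β → Λ) (G : Θ → Β → Ξ) (π : Ξ → Θ) (hπ : ∀ t b, π (G t b) = t) (μ μ' : Θ → ℝ)
    (hblind : ∀ ξ, (∑ t, ∑ b, if G t b = ξ then μ t else 0) = ∑ t, ∑ b, if G t b = ξ then μ' t else 0) :
    ∀ l, (∑ t, ∑ b, if F t b = l then μ t else 0) = ∑ t, ∑ b, if F t b = l then μ' t else 0 := by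
  classical
  -- fibre counts over the routing words at the arc system forced by `ξ`
  set M : Ξ → ℕ := fun ξ ↦ (univ.filter fun b : Β ↦ G (π ξ) b = ξ).card with hM
  set N : Ξ → Λ → ℕ := fun ξ l ↦ (univ.filter fun b : Β ↦ G (π ξ) b = ξ ∧ F (π ξ) b = l).card with hN
  -- key identity: for any weight `ν`, the loop mass at `l` is `∑_ξ ν (π ξ) * N ξ l`, and the blind mass at `ξ` is
  -- `ν (π ξ) * M ξ`; with `N ξ l ≤ M ξ` the blind masses determine the loop masses.
  have loopMass : ∀ ν : Θ → ℝ, ∀ l, (∑ t, ∑ b, if F t b = l then ν t else 0) =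
      ∑ ξ ∈ univ.image (fun p : Θ × Β ↦ G p.1 p.2), ν (π ξ) * N ξ l := by
    intro ν l
    sorry
  have blindMass : ∀ ν : Θ → ℝ, ∀ ξ, (∑ t, ∑ b, if G t b = ξ then ν t else 0) = ν (π ξ) * M ξ := by
    intro ν ξ
    sorry
  have hNM : ∀ ξ l, N ξ l ≤ M ξ := fun ξ l ↦ card_le_card (fun b hb ↦ by
    simp only [mem_filter, mem_univ, true_and] at hb ⊢; exact hb.1)
  intro l
  rw [loopMass μ l, loopMass μ' l]
  refine sum_congr rfl fun ξ _ ↦ ?_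
  by_cases hMξ : M ξ = 0
  · have : N ξ l = 0 := Nat.eq_zero_of_le_zero (hMξ ▸ hNM ξ l)
    simp [this]
  · have hb := hblind ξ
    rw [blindMass μ ξ, blindMass μ' ξ] at hb
    have hMpos : (M ξ : ℝ) ≠ 0 := by exact_mod_cast hMξ
    have : μ (π ξ) = μ' (π ξ) := mul_right_cancel₀ hMpos hb
    rw [this]
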